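import Literature.AlgebraicGeometry.Frobenioids.TwinPrimaryTransport
import Literature.AlgebraicGeometry.Frobenioids.Thm49Sub
import HarnessLib

/-!
# [FrdI] Theorem 4.9, sub-DAG S5 row T49-L08 (repaired form `PsiPreservesTwinPrimary'`) — closer

Mochizuki, *The geometry of Frobenioids I: the general theory*, Kyushu J. Math. **62** (2008)
293–400, proof of Theorem 4.9, kurims text p. 90 ll. 28–54 [cite: MochizukiFrdI2008, Thm. 4.9 p.90].

PROOF-ONLY file (seat abc-iut-w4-d105; D-0068 sub-DAG S5 `FrdI:Thm4.9/T49-L08`, L1-lead MENU M12;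
GAP-LEDGER row G-w4d105-1 / finding T49-F1). The statements file `Thm49Sub.lean` now carries the
repaired row `FrdI.T49.PsiPreservesTwinPrimary'` (the two cartesian squares are squares "as in
Proposition 4.1, (iii)", i.e. over co-primary pairs). This file discharges it by the transport theorem
`FrdI.T49.isTwinPrimary_map_of_coprimary_squares` (`TwinPrimaryTransport.lean`), whose binder list it
matches verbatim. The unrepaired row `FrdI.T49.PsiPreservesTwinPrimary` is refuted at universe `0`
in `Thm49TwinPrimaryWitness.lean` (`FrdI.T49.not_psiPreservesTwinPrimary`). No new definitions;
nothing of [FrdI] is restated.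
-/

namespace Literature.AlgebraicGeometry.Frobenioids

namespace FrdI.T49

universe w v v' u u'

set_option backward.isDefEq.respectTransparency false in
/-- **[FrdI] Thm. 4.9, row T49-L08 (repaired), discharged**: `Ψ` maps the twin-primary pair `(α, β)`
read off from two cartesian squares of pre-steps over co-primary pairs ("as in Proposition 4.1,
(iii)") with `ζ := β ∘ γ`, `γ''` Div-equivalent to a twin-primary pair of `C₂` — the statement
`FrdI.T49.PsiPreservesTwinPrimary'` holds at every universe level, by
`FrdI.T49.isTwinPrimary_map_of_coprimary_squares`.
[cite: MochizukiFrdI2008, Thm. 4.9 p.90 ll.28–54] -/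
theorem psiPreservesTwinPrimary'_holds : PsiPreservesTwinPrimary'.{w, v, v', u, u'} :=
  fun F₁ F₂ Ψ hS _ _ hprim hdiveq _ _ _ _ _ α β γ γ' δ γ'' δ' hα hαp hβ hβp hγ hγ' hδ hγ'' hδ' sq₁ sq₂
    cart₁ cart₂ cop₁ cop₂ hde =>
    isTwinPrimary_map_of_coprimary_squares F₁ F₂ Ψ hS hprim hdiveq α β γ γ' δ γ'' δ' hα hαp hβ hβp hγ hγ'
      hδ hγ'' hδ' sq₁ sq₂ cart₁ cart₂ cop₁ cop₂ hde

end FrdI.T49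

end Literature.AlgebraicGeometry.Frobenioids
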